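import Mathlib
import Summits.Ventures.PercRepro2.KPrimeCycle
import Summits.Ventures.PercRepro2.KPrimeTCycle5Cert1
import Summits.Ventures.PercRepro2.KPrimeTCycle5Cert2
import Summits.Ventures.PercRepro2.KPrimeTCycle5Cert3
import Summits.Ventures.PercRepro2.KPrimeTCycle5Cert4
import Summits.Ventures.PercRepro2.KPrimeTCycle5Cert5
import Summits.Ventures.PercRepro2.KPrimeTCycle5Cert6
import Summits.Ventures.PercRepro2.CycleNecklace

/-!
# `(K′-T)` on every cycle and every necklace (blind cell PercRepro2, mine-c g41;
`conjectures/MINE-C.md` §50.3)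

The margin form `(K′-T)` of the `v`-exploration (`KPrime.mtForm`, `KPrimeLeafMartingale.lean`,
mine-c g34) — the hypothesis of the improved pendant step `kprime_of_pendant_T`
(`KPrimePendantT.lean`: `(K′)_z ∧ (K′-T)_z ⟹ (K′)_v` for `v` a leaf at `z`, at every weight of the
leaf edge) — is Bernstein-positive on `C₅` at every placement (`KPrimeTCycle5Cert1–6.lean`), and
transports exactly as `(K′)` does: **`kprimeT_cycle`** (every `n`-cycle, every admissible weight
vector, every placement of the five distinct marks) and **`kprimeT_necklace`** (every necklace).
With `kprime_cycle` / `kprime_necklace` of `KPrimeCycle.lean` / `KPrimeNecklace.lean`, both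
hypotheses of the pendant step hold on cycles and necklaces, and with `kprimeT_of_leaf` they are
inherited along pendant paths at `v`.
-/

namespace Summit.Ventures.PercRepro2

namespace KPrimeCycle

open Cycle

/-! ## Transport of the margin form -/

section Transport

variable {V : Type*} {E : Type*} {V' : Type*} {E' : Type*} [Fintype E] [DecidableEq E]
  [Fintype E'] [DecidableEq E'] [DecidableEq V] [DecidableEq V'] {R : Type*} [Field R]

/-- **Transport of the margin form `mtForm` across types.** -/
theorem mtForm_transport' {q : E → R} {p : E' → R} {ends : E → Sym2 V}
    {ends' : E' → Sym2 V'} {Ψ : Config E' → Config E} {φ : V → V'}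
    (hP : ∀ A : Set (Config E), prob q A = prob p (Ψ ⁻¹' A))
    (hH : ∀ ω x z, Conn ends (Ψ ω) x z ↔ Conn ends' ω (φ x) (φ z)) (a₁ a₂ b v y : V) :
    KPrime.mtForm ends a₁ a₂ b v y q =
      KPrime.mtForm ends' (φ a₁) (φ a₂) (φ b) (φ v) (φ y) p := by
  simp only [KPrime.mtForm, KPrime.cls01e, KPrime.cls01, KPrime.S, KPrime.Ω, hP,
    Set.preimage_inter, Set.preimage_union, Set.preimage_compl, preimage_connEvent' hH,
    preimage_avoidAll_singleton' hH, preimage_avoidAll_pair' hH]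

variable [LinearOrder R]

/-- **Transport of `(K′-T)` across types.** -/
theorem kprimeTHolds_transport' {q : E → R} {p : E' → R} {ends : E → Sym2 V}
    {ends' : E' → Sym2 V'} {Ψ : Config E' → Config E} {φ : V → V'}
    (hP : ∀ A : Set (Config E), prob q A = prob p (Ψ ⁻¹' A))
    (hH : ∀ ω x z, Conn ends (Ψ ω) x z ↔ Conn ends' ω (φ x) (φ z)) (a₁ a₂ b v y : V) :
    KPrime.KPrimeTHolds ends a₁ a₂ b v y q ↔
      KPrime.KPrimeTHolds ends' (φ a₁) (φ a₂) (φ b) (φ v) (φ y) p := by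
  simp only [KPrime.KPrimeTHolds, mtForm_transport' hP hH]

end Transport

/-! ## `(K′-T)` on the 5-cycle at every placement -/

section Cycle5

variable {R : Type*} [Field R] [LinearOrder R] [IsStrictOrderedRing R]

/-- The `24` placements of the marks `a₂, b, v, y` on `C₅ ∖ {0}`, as a list (decided). -/
lemma placements_zero_aux : ∀ a₂ b v y : Fin 5, ¬ ((0 : Fin 5) ≠ a₂ ∧ (0 : Fin 5) ≠ b ∧ (0 : Fin 5) ≠ v ∧ (0 : Fin 5) ≠ y ∧ a₂ ≠ b ∧ a₂ ≠ v ∧ a₂ ≠ y ∧ b ≠ v ∧ b ≠ y ∧ v ≠ y) ∨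
      (a₂, b, v, y) ∈ ([(1, 2, 3, 4), (1, 2, 4, 3), (1, 3, 2, 4), (1, 3, 4, 2), (1, 4, 2, 3), (1, 4, 3, 2), (2, 1, 3, 4), (2, 1, 4, 3), (2, 3, 1, 4), (2, 3, 4, 1), (2, 4, 1, 3), (2, 4, 3, 1), (3, 1, 2, 4), (3, 1, 4, 2), (3, 2, 1, 4), (3, 2, 4, 1), (3, 4, 1, 2), (3, 4, 2, 1), (4, 1, 2, 3), (4, 1, 3, 2), (4, 2, 1, 3), (4, 2, 3, 1), (4, 3, 1, 2), (4, 3, 2, 1)] : List (Fin 5 × Fin 5 × Fin 5 × Fin 5)) := by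
  decide

/-- The `24` placements of the marks `a₂, b, v, y` on `C₅ ∖ {0}`. -/
lemma placements_zero (a₂ b v y : Fin 5) (h02 : (0 : Fin 5) ≠ a₂) (h0b : (0 : Fin 5) ≠ b)
    (h0v : (0 : Fin 5) ≠ v) (h0y : (0 : Fin 5) ≠ y) (h2b : a₂ ≠ b) (h2v : a₂ ≠ v) (h2y : a₂ ≠ y)
    (hbv : b ≠ v) (hby : b ≠ y) (hvy : v ≠ y) :
      (a₂ = 1 ∧ b = 2 ∧ v = 3 ∧ y = 4) ∨
      (a₂ = 1 ∧ b = 2 ∧ v = 4 ∧ y = 3) ∨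
      (a₂ = 1 ∧ b = 3 ∧ v = 2 ∧ y = 4) ∨
      (a₂ = 1 ∧ b = 3 ∧ v = 4 ∧ y = 2) ∨
      (a₂ = 1 ∧ b = 4 ∧ v = 2 ∧ y = 3) ∨
      (a₂ = 1 ∧ b = 4 ∧ v = 3 ∧ y = 2) ∨
      (a₂ = 2 ∧ b = 1 ∧ v = 3 ∧ y = 4) ∨
      (a₂ = 2 ∧ b = 1 ∧ v = 4 ∧ y = 3) ∨
      (a₂ = 2 ∧ b = 3 ∧ v = 1 ∧ y = 4) ∨
      (a₂ = 2 ∧ b = 3 ∧ v = 4 ∧ y = 1) ∨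
      (a₂ = 2 ∧ b = 4 ∧ v = 1 ∧ y = 3) ∨
      (a₂ = 2 ∧ b = 4 ∧ v = 3 ∧ y = 1) ∨
      (a₂ = 3 ∧ b = 1 ∧ v = 2 ∧ y = 4) ∨
      (a₂ = 3 ∧ b = 1 ∧ v = 4 ∧ y = 2) ∨
      (a₂ = 3 ∧ b = 2 ∧ v = 1 ∧ y = 4) ∨
      (a₂ = 3 ∧ b = 2 ∧ v = 4 ∧ y = 1) ∨
      (a₂ = 3 ∧ b = 4 ∧ v = 1 ∧ y = 2) ∨
      (a₂ = 3 ∧ b = 4 ∧ v = 2 ∧ y = 1) ∨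
      (a₂ = 4 ∧ b = 1 ∧ v = 2 ∧ y = 3) ∨
      (a₂ = 4 ∧ b = 1 ∧ v = 3 ∧ y = 2) ∨
      (a₂ = 4 ∧ b = 2 ∧ v = 1 ∧ y = 3) ∨
      (a₂ = 4 ∧ b = 2 ∧ v = 3 ∧ y = 1) ∨
      (a₂ = 4 ∧ b = 3 ∧ v = 1 ∧ y = 2) ∨
      (a₂ = 4 ∧ b = 3 ∧ v = 2 ∧ y = 1) := by
  have h := (placements_zero_aux a₂ b v y).resolve_left fun h =>
    h ⟨h02, h0b, h0v, h0y, h2b, h2v, h2y, hbv, hby, hvy⟩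
  simpa only [List.mem_cons, List.mem_nil_iff, or_false, Prod.mk.injEq] using h

/-- `(K′-T)` on `C₅` at every placement with `a₁ = 0`: the `24` certificates. -/
theorem kprimeT_cycle5_zero (w : Fin 5 → R) (hw : IsProbVec w) (a₂ b v y : Fin 5)
    (h02 : (0 : Fin 5) ≠ a₂) (h0b : (0 : Fin 5) ≠ b) (h0v : (0 : Fin 5) ≠ v) (h0y : (0 : Fin 5) ≠ y)
    (h2b : a₂ ≠ b) (h2v : a₂ ≠ v) (h2y : a₂ ≠ y) (hbv : b ≠ v) (hby : b ≠ y) (hvy : v ≠ y) :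
    KPrime.KPrimeTHolds (cycN 5) 0 a₂ b v y w := by
  rcases placements_zero a₂ b v y h02 h0b h0v h0y h2b h2v h2y hbv hby hvy with
    h | h | h | h | h | h | h | h | h | h | h | h | h | h | h | h | h | h | h | h | h | h | h | h
  · obtain ⟨rfl, rfl, rfl, rfl⟩ := h
    exact KPrimeTCycle5.kprimeT_01234 w hw
  · obtain ⟨rfl, rfl, rfl, rfl⟩ := h
    exact KPrimeTCycle5.kprimeT_01243 w hw
  · obtain ⟨rfl, rfl, rfl, rfl⟩ := h
    exact KPrimeTCycle5.kprimeT_01324 w hw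
  · obtain ⟨rfl, rfl, rfl, rfl⟩ := h
    exact KPrimeTCycle5.kprimeT_01342 w hw
  · obtain ⟨rfl, rfl, rfl, rfl⟩ := h
    exact KPrimeTCycle5.kprimeT_01423 w hw
  · obtain ⟨rfl, rfl, rfl, rfl⟩ := h
    exact KPrimeTCycle5.kprimeT_01432 w hw
  · obtain ⟨rfl, rfl, rfl, rfl⟩ := h
    exact KPrimeTCycle5.kprimeT_02134 w hw
  · obtain ⟨rfl, rfl, rfl, rfl⟩ := h
    exact KPrimeTCycle5.kprimeT_02143 w hw
  · obtain ⟨rfl, rfl, rfl, rfl⟩ := h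
    exact KPrimeTCycle5.kprimeT_02314 w hw
  · obtain ⟨rfl, rfl, rfl, rfl⟩ := h
    exact KPrimeTCycle5.kprimeT_02341 w hw
  · obtain ⟨rfl, rfl, rfl, rfl⟩ := h
    exact KPrimeTCycle5.kprimeT_02413 w hw
  · obtain ⟨rfl, rfl, rfl, rfl⟩ := h
    exact KPrimeTCycle5.kprimeT_02431 w hw
  · obtain ⟨rfl, rfl, rfl, rfl⟩ := h
    exact KPrimeTCycle5.kprimeT_03124 w hw
  · obtain ⟨rfl, rfl, rfl, rfl⟩ := h
    exact KPrimeTCycle5.kprimeT_03142 w hw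
  · obtain ⟨rfl, rfl, rfl, rfl⟩ := h
    exact KPrimeTCycle5.kprimeT_03214 w hw
  · obtain ⟨rfl, rfl, rfl, rfl⟩ := h
    exact KPrimeTCycle5.kprimeT_03241 w hw
  · obtain ⟨rfl, rfl, rfl, rfl⟩ := h
    exact KPrimeTCycle5.kprimeT_03412 w hw
  · obtain ⟨rfl, rfl, rfl, rfl⟩ := h
    exact KPrimeTCycle5.kprimeT_03421 w hw
  · obtain ⟨rfl, rfl, rfl, rfl⟩ := h
    exact KPrimeTCycle5.kprimeT_04123 w hw
  · obtain ⟨rfl, rfl, rfl, rfl⟩ := h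
    exact KPrimeTCycle5.kprimeT_04132 w hw
  · obtain ⟨rfl, rfl, rfl, rfl⟩ := h
    exact KPrimeTCycle5.kprimeT_04213 w hw
  · obtain ⟨rfl, rfl, rfl, rfl⟩ := h
    exact KPrimeTCycle5.kprimeT_04231 w hw
  · obtain ⟨rfl, rfl, rfl, rfl⟩ := h
    exact KPrimeTCycle5.kprimeT_04312 w hw
  · obtain ⟨rfl, rfl, rfl, rfl⟩ := h
    exact KPrimeTCycle5.kprimeT_04321 w hw

/-- **`(K′-T)` on the `5`-cycle for every admissible weight vector and every placement of the
five distinct marks**: rotate the cycle so that `a₁` sits at `0` and use the certificates. -/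
theorem kprimeT_cycle5_all (w : Fin 5 → R) (hw : IsProbVec w) (a₁ a₂ b v y : Fin 5)
    (h12 : a₁ ≠ a₂) (h1b : a₁ ≠ b) (h1v : a₁ ≠ v) (h1y : a₁ ≠ y) (h2b : a₂ ≠ b) (h2v : a₂ ≠ v)
    (h2y : a₂ ≠ y) (hbv : b ≠ v) (hby : b ≠ y) (hvy : v ≠ y) :
    KPrime.KPrimeTHolds (cycN 5) a₁ a₂ b v y w := by
  set σ : Fin 5 ≃ Fin 5 := shiftEquiv a₁ with hσ
  set w' : Fin 5 → R := w ∘ σ with hw'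
  have hw'p : IsProbVec w' := ⟨fun i => hw.nonneg _, fun i => hw.le_one _⟩
  have hP : ∀ A : Set (Config (Fin 5)),
      prob w A = prob w' ((fun ω : Config (Fin 5) => fun i => ω (i - a₁)) ⁻¹' A) := by
    intro A
    have h := prob_comp_equiv σ.symm w' A
    have hw'' : w' ∘ σ.symm = w := by
      ext i
      simp [hw', Function.comp, hσ, shiftEquiv, sub_add_cancel]
    rw [hw''] at h
    exact h
  have hH : ∀ (ω : Config (Fin 5)) (x z : Fin 5),
      Conn (cycN 5) ((fun ω : Config (Fin 5) => fun i => ω (i - a₁)) ω) x z ↔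
        Conn (cycN 5) ω (x - a₁) (z - a₁) := fun ω x z => conn_cycN_shift ω a₁ x z
  rw [kprimeTHolds_transport' hP hH, sub_self]
  refine kprimeT_cycle5_zero w' hw'p (a₂ - a₁) (b - a₁) (v - a₁) (y - a₁) ?_ ?_ ?_ ?_ ?_ ?_ ?_
    ?_ ?_ ?_
  · exact fun h => h12 (sub_eq_zero.1 h.symm).symm
  · exact fun h => h1b (sub_eq_zero.1 h.symm).symm
  · exact fun h => h1v (sub_eq_zero.1 h.symm).symm
  · exact fun h => h1y (sub_eq_zero.1 h.symm).symm
  · exact fun h => h2b (sub_left_injective h)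
  · exact fun h => h2v (sub_left_injective h)
  · exact fun h => h2y (sub_left_injective h)
  · exact fun h => hbv (sub_left_injective h)
  · exact fun h => hby (sub_left_injective h)
  · exact fun h => hvy (sub_left_injective h)

end Cycle5

/-! ## `(K′-T)` on every cycle and every necklace -/

section Theorem

variable {R : Type*} [Field R] [LinearOrder R] [IsStrictOrderedRing R]

/-- **`(K′-T)` on the `n`-cycle** for every admissible weight vector and every placement of the
five distinct marks (`conn_marks_iff`, `prob_arcOpen_preimage`, `kprimeTHolds_transport'`,
`kprimeT_cycle5_all`). -/
theorem kprimeT_cycle {n : ℕ} [NeZero n] (p : Fin n → R) (hp : IsProbVec p) (a₁ a₂ b v y : Fin n)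
    (h12 : a₁ ≠ a₂) (h1b : a₁ ≠ b) (h1v : a₁ ≠ v) (h1y : a₁ ≠ y) (h2b : a₂ ≠ b) (h2v : a₂ ≠ v)
    (h2y : a₂ ≠ y) (hbv : b ≠ v) (hby : b ≠ y) (hvy : v ≠ y) :
    KPrime.KPrimeTHolds (cycN n) a₁ a₂ b v y p := by
  have hM := card_marks a₁ a₂ b v y h12 h1b h1v h1y h2b h2v h2y hbv hby hvy
  set qe := (marks a₁ a₂ b v y).orderEmbOfFin hM with hqe
  have hq : StrictMono (⇑qe) := qe.strictMono
  obtain ⟨k₁, hk₁⟩ := exists_orderEmb_eq hM (x := a₁) (by simp [marks])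
  obtain ⟨k₂, hk₂⟩ := exists_orderEmb_eq hM (x := a₂) (by simp [marks])
  obtain ⟨kb, hkb⟩ := exists_orderEmb_eq hM (x := b) (by simp [marks])
  obtain ⟨kv, hkv⟩ := exists_orderEmb_eq hM (x := v) (by simp [marks])
  obtain ⟨ky, hky⟩ := exists_orderEmb_eq hM (x := y) (by simp [marks])
  rw [← hqe] at hk₁ hk₂ hkb hkv hky
  have key : KPrime.KPrimeTHolds (cycN n) a₁ a₂ b v y p ↔
      KPrime.KPrimeTHolds (cycN 5) k₁ k₂ kb kv ky (arcProb (⇑qe) p) := by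
    rw [← hk₁, ← hk₂, ← hkb, ← hkv, ← hky]
    exact (kprimeTHolds_transport' (fun A => (prob_arcOpen_preimage hq p A).symm)
      (fun ω x z => (conn_marks_iff hq ω x z).symm) k₁ k₂ kb kv ky).symm
  have d12 : k₁ ≠ k₂ := fun h => h12 (by rw [← hk₁, ← hk₂, h])
  have d1b : k₁ ≠ kb := fun h => h1b (by rw [← hk₁, ← hkb, h])
  have d1v : k₁ ≠ kv := fun h => h1v (by rw [← hk₁, ← hkv, h])
  have d1y : k₁ ≠ ky := fun h => h1y (by rw [← hk₁, ← hky, h])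
  have d2b : k₂ ≠ kb := fun h => h2b (by rw [← hk₂, ← hkb, h])
  have d2v : k₂ ≠ kv := fun h => h2v (by rw [← hk₂, ← hkv, h])
  have d2y : k₂ ≠ ky := fun h => h2y (by rw [← hk₂, ← hky, h])
  have dbv : kb ≠ kv := fun h => hbv (by rw [← hkb, ← hkv, h])
  have dby : kb ≠ ky := fun h => hby (by rw [← hkb, ← hky, h])
  have dvy : kv ≠ ky := fun h => hvy (by rw [← hkv, ← hky, h])
  rw [key]
  exact kprimeT_cycle5_all (arcProb (⇑qe) p) (isProbVec_arcProb (⇑qe) hp) k₁ k₂ kb kv ky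
    d12 d1b d1v d1y d2b d2v d2y dbv dby dvy

variable {V : Type*} {E : Type*} [Fintype E] [DecidableEq E] [DecidableEq V]
variable {ends : E → Sym2 V} {q : Fin 5 → V} {blk : E → Fin 5} {Vj : Fin 5 → Set V}

/-- **`(K′-T)` on every necklace** for every admissible weight vector and every placement of the
five labels on the five marks (`conn_marks_iff_nk`, `prob_nkOpen_preimage`). -/
theorem kprimeT_necklace (hN : IsNecklace ends q blk Vj) (p : E → R) (hp : IsProbVec p)
    (k₁ k₂ kb kv ky : Fin 5) (h12 : k₁ ≠ k₂) (h1b : k₁ ≠ kb) (h1v : k₁ ≠ kv) (h1y : k₁ ≠ ky)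
    (h2b : k₂ ≠ kb) (h2v : k₂ ≠ kv) (h2y : k₂ ≠ ky) (hbv : kb ≠ kv) (hby : kb ≠ ky)
    (hvy : kv ≠ ky) : KPrime.KPrimeTHolds ends (q k₁) (q k₂) (q kb) (q kv) (q ky) p := by
  rw [(kprimeTHolds_transport' (fun A => (prob_nkOpen_preimage p A).symm)
    (fun ω x z => (conn_marks_iff_nk hN ω x z).symm) k₁ k₂ kb kv ky).symm]
  exact kprimeT_cycle5_all (nkProb ends q blk p) (isProbVec_nkProb hp) k₁ k₂ kb kv ky
    h12 h1b h1v h1y h2b h2v h2y hbv hby hvy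

end Theorem

end KPrimeCycle

end Summit.Ventures.PercRepro2
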